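import Summits.QuantumFields.BalabanUV.T4Continuum.Support.ShellMeasureLandauEndAssembledDecayCfKept
import Summits.QuantumFields.BalabanUV.T4Continuum.Support.ShellMeasureThresholdUnits

/-!
# `T4Continuum.ShellMeasureLiveEndOneCallSlotHistories` — row S103b file 1‴: THE LIVE-LEVEL END-II ON THE KEPT HOST (S99 f4 `…_cfB7_kept` ∘ the γ8 unit change S90) PER HISTORY `τ`
# — the density side of the binder families HISTORY-INDEXED, the classifier side not — for BOTH runs and every slot
(cell `pub-balaban`, sub-cell `t4`, spine estimate NE7c (node U5b); NE7c ROUND-2 crew, unit `b2b-balaban-t4-ne7c-formalise-leaf-09`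
gen 13; owner table `t4/b2b-balaban-t4-ne7c-p1/LEAVES-NE7c-P1.md` row **S103b** «THE ONE CALL ON THE HISTORIES ROAD» (R-ne7cp1-g35-6
(b): first refusal leaf-09 after S102 and S103a; R-ne7cp1-g36-7 (b)(iii): wired over the KEPT host on leaf-03-g8's N-ne7cleaf03g8-1); ADDITIVE —
imports S99 f4 `ShellMeasureLandauEndAssembledDecayCfKept` (leaf-03-g8: S99 f3b VERBATIM with the slot's OWN indicator kept in the measure) and S90
`ShellMeasureThresholdUnits` ONLY; [folklore]; 0 `def`, 0 `def … : Prop`, 0 sorry, 0 citation tags; the statement is GENERATED from S99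
f4's signature (= f3b's binders VERBATIM) by the S92∕S95∕S102 script in mode `histL` — `HOME/b2b-balaban-t4-ne7c-formalise-leaf-09/g13/s103/`)

HONEST FRAMING.  Finite four-torus programme, rung (B)+1 only — NOT infinite volume, NOT a mass gap, NOT the Clay problem, NOT
summit progress; (B), `BetaPertHyp`, (B^μ) not consumed.  NE7c (`T4IndicatorShell.ShellWeightBound`) is NOT PRINTED in
[Balaban 1983–89] and NOT PROVED; «NE7c ⇐ the named binders» (trigger c3): every binder below is DISPLAYED, asserted by nobody;
no estimate of Bałaban's is discharged; (M1) realized ≠ NE7c.  Equation numbers in comments LOCATE displayed shapes, not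
citations.  HONEST DEPENDENCY (cell): continuum YM on T⁴ ⇐ BetaPertH ∧ nine spine estimates (0/9 proved); BetaPertH ⇐ (D1) ∧ (D4)
∧ CAP+tail; G-an2-4 gates asym, D1 and NE2/3/4.

WHAT IS PROVED ([folklore]).  **`hac_live_of_assembled_decay_histories_cfB7`** — S102 f1″ `ShellMeasureLiveEndOneCallSlotHistoriesLevelsCf.
hac_live_of_assembled_decay_histories_cfB7_levels_cfB7` with ONE MORE INDEX: the history `τ : ι` of the term in which the slot is live.  For run `r`,
comparison `K`, source `t`, slot `s` on its own lattice `(P r K s, jl r K s)` and history `τ`, EVERY binder of S99 f4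
`slotAC_realized_su2_landauChart_assembled_decay_cfB7_kept` (= f3b's) as a family: types, box∕chart geometry (`lo hi nb Λ m₀ e`, level `k`, B7 index
sets), the C*-carrier by `(r, K, s)`; THE CLASSIFIER SIDE — the tested variable `u`, its plaquettes `Pu`, the localized (T1) tuple `𝒢 W𝒱 H₁
Φ ιs Hop`, the read-outs `ℓs`, the (T1) real structure `L 𝓡𝒵 𝓡ℬ`, the dictionary `hudict`, the core reading `Pcore hcore` — by `(r, K, t, s)`
(B14 (2.16) TYPE: the cube's tested variable does not depend on the term; S103a's layer variable `u′` is τ-free); THE DENSITY SIDE — `F hF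
hFi`, the window∕co-test `W Jco hJW hJ hJ1 hWS`, the dictionary `hRdict`, the collar reading `Pcollar hcollar hcover`, the global (T2) tuple
(stations, pins, decay kernels, flat lists, localities, read-outs, real structure, frozen prefactors, weight plaquettes, the background `Ubg`
with its LOCATED regularity `h52locw h52loce`, the e-pins), the (T3) tuple and the (S78) dressed terms — by `(r, K, t, s, τ)` (a term's
sectioned density, its large-field geometry and its determining set vary with the history — indexing them is the honest typing; the
LIFT-RULE letters `κr κc κwb κcb dbar Kw` stay level profiles, Bałaban's uniform numbers stay shared) ⟹ `∀ r K t s τ, SlotAntiConcentration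
((fieldMeasure (P r K s) (jl r K s) SU2).withDensity ({U | u r K t s U < ε r (K − lvl r K s)·η r (jl r K s)²}.indicator (F r K t s τ)))
(u r K t s ∕ η r (jl r K s)²) (ε r (K − lvl r K s)) (ρ r (lvl r K s)) (S99 f3b's slot constant at (r, K, s))` — the KEPT measure (the slot's
OWN small-field indicator retained — the form the designed layer identification of the histories road inhabits, leaf-03-g8's
N-ne7cleaf03g8-1 ∕ `ShellMeasureHistoriesTransportKept.map_withDensity_tower_indicator`); ONE call of S99 f4, then S90
`slotAntiConcentration_thresholdUnits`.  File 2‴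
`ShellMeasureLiveEndOneCallHistories` transports it to the histories road (S103a) and closes with S90 f3.  Renamings as S92∕S102 (`ιc`,
`Aex`, `zs`, the e-reach's `b`).
-/

noncomputable section

open Set Metric NormedSpace MeasureTheory Function Finset
open scoped ENNReal

namespace Summit.QuantumFields.BalabanUV.T4Continuum.ShellMeasureLiveEndOneCallSlotHistories

open Literature.MathematicalPhysics.QuantumFieldTheory.Balaban1983to89
open B11Prop6Scheme (Prop4Hyp)
open GaugeField (GaugeInvariant)
open T4ShellMeasure (SlotAntiConcentration)
open T4CubePoincare (cube)
open T4CubeChartGnomonic (SU2)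
open T4CubeChartExp (expFibreChart)
open T4TreeGaugeFixing (NoClosedLoop fixTo)
open T4ShellMeasurePlaquette (expTail₂)
open ShellMeasureLevelAssembly (classifier)
open ShellMeasureMultiGridNorms (WSup)
open ShellMeasurePinnedNorm (pinW)
open ShellMeasureDecayKernelSums (kerOp)
open ShellMeasureLandauHolonomy (solAt landauExp)
open ShellMeasureLandauHolonomyChart (holOf cplx)
open ShellMeasureLandauHolonomySkew (readOutReal)
open ShellMeasureMultiGridNorms.WSup (toPiL)
open T4AxialGaugeSmallField (boxPlaqs boxBonds)
open T4AxialGaugeFixing (combBonds)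
open B7Prop2Explicit (C0 c2' unitaryUnits)
open B7Prop1Local (pdevOn loK bondHiK)
open B7Prop5Flat (BondIn)
open ShellMeasureAverageProp4General (O1cov C2cov)
open ShellMeasureLandauCorrectionB7 (landauCf landauRad)
open ShellMeasureLandauCorrectionReal (skewPi)
open ShellMeasureLandauCfBoxLocal (landauCfBox)
open ShellMeasureThresholdUnits (slotAntiConcentration_thresholdUnits)
open ShellMeasureLandauEndAssembledDecayCfKept (slotAC_realized_su2_landauChart_assembled_decay_cfB7_kept)

open scoped Matrix.Norms.L2Operator

variable {σ ι : Type*} {n : Type*} [Fintype n] [DecidableEq n] [Nonempty n]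

/-- **THE LIVE-LEVEL END-II OF RECORD IN THRESHOLD UNITS, OVER THE INDEXED FAMILIES** (row S103b file 1‴; see the module
docstring; per history `τ`).  CONDITIONAL on every displayed binder; nothing PRINTED is asserted; NOT Bałaban's minimiser;
NE7c NOT PROVED. [folklore] -/
theorem hac_live_of_assembled_decay_histories_cfB7
    (P : Bool → ℕ → σ → Params) (jl lvl : Bool → ℕ → σ → ℕ) [∀ r K s, DecidableEq (PBond (P r K s) (jl r K s))]
    {ε η ρ β : Bool → ℕ → ℝ} (hη : ∀ r j, 0 < η r j) (hε : ∀ r a, 0 < ε r a) (hρ0 : ∀ r j, 0 ≤ ρ r j)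
    {𝒴 𝒵 ℬ : Bool → ℕ → σ → Type*} [∀ r K s, NormedAddCommGroup (𝒴 r K s)] [∀ r K s, NormedSpace ℂ (𝒴 r K s)]
    [∀ r K s, CompleteSpace (𝒴 r K s)] [∀ r K s, NormedAddCommGroup (𝒵 r K s)] [∀ r K s, NormedSpace ℂ (𝒵 r K s)]
    [∀ r K s, NormedAddCommGroup (ℬ r K s)] [∀ r K s, NormedSpace ℂ (ℬ r K s)] {𝔸 : Bool → ℕ → σ → Type*}
    [∀ r K s, CStarAlgebra (𝔸 r K s)] [∀ r K s, Nontrivial (𝔸 r K s)]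
    -- the BOX `[lo, hi]` (the block `□^{∼4}`: `nb` unit steps per direction, non-wrapping on the torus) and its a …
    {lo hi : ∀ r K s, Fin (P r K s).d → ℤ} {nb : Bool → ℕ → σ → ℕ} (hn : ∀ r K s, ∀ κ, hi r K s κ ≤ lo r K s κ + nb r K s)
    (hN : ∀ r K s, ∀ κ, hi r K s κ - lo r K s κ < (P r K s).sitesPerDir (jl r K s))
    (Λ : ∀ r K s, Finset (PBond (P r K s) (jl r K s))) (hΛbox : ∀ r K s, ∀ b ∈ Λ r K s, b ∈ boxBonds (lo r K s) (hi r K s))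
    (hΛcomb : ∀ r K s, Disjoint (Λ r K s) (combBonds (lo r K s) (hi r K s))) {m₀ : Bool → ℕ → σ → ℕ}
    (e : ∀ r K s, ↥(Λ r K s) × Fin 3 ≃ Fin (m₀ r K s)) {S : ℝ} (hS : 0 < S) (hSπ : 3 * S ^ 2 < Real.pi ^ 2)
    {F : ∀ r K (t : ℝ) s (τ : ι), GaugeField (P r K s) (jl r K s) SU2 → ℝ≥0∞} (hF : ∀ r K t s τ, Measurable (F r K t s τ))
    (hFi : ∀ r K t s τ, GaugeInvariant (F r K t s τ)) {u : ∀ r K (t : ℝ) s, GaugeField (P r K s) (jl r K s) SU2 → ℝ}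
    (hu : ∀ r K t s, Measurable (u r K t s)) (hui : ∀ r K t s, GaugeInvariant (u r K t s)) {ιc : Bool → ℕ → σ → Type*}
    {Pu : ∀ r K (t : ℝ) s, Finset (ιc r K s)} (hPu : ∀ r K t s, (Pu r K t s).Nonempty)
    (W : ∀ r K (t : ℝ) s (τ : ι), GaugeField (P r K s) (jl r K s) SU2 → Set (Fin (m₀ r K s) → ℝ))
    (Jco : ∀ r K (t : ℝ) s (τ : ι), GaugeField (P r K s) (jl r K s) SU2 → (Fin (m₀ r K s) → ℝ) → ℝ≥0∞) {δ : ℝ}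
    (𝒢 : ∀ r K (t : ℝ) s, GaugeField (P r K s) (jl r K s) SU2 → (𝒵 r K s →L[ℂ] (𝒴 r K s)))
    (W𝒱 : ∀ r K (t : ℝ) s, GaugeField (P r K s) (jl r K s) SU2 → 𝒴 r K s → 𝒵 r K s) {B₀ C₄ a₃ ε₄ : ℝ}
    (h𝒢 : ∀ r K t s, ∀ V f, ‖𝒢 r K t s V f‖ ≤ B₀ * ‖f‖) (hW : ∀ r K t s, ∀ V, Prop4Hyp (W𝒱 r K t s V) C₄ a₃) (hB₀ : 0 < B₀)
    (hC₄ : 0 ≤ C₄) (hε₄ : 0 ≤ ε₄) {dL C₁ B₃ ε₁ : ℝ} (hdL : 0 ≤ dL) (hC₁ : 0 ≤ C₁) (hε₁ : 0 ≤ ε₁) (hB₃ : dL ≤ B₃)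
    (h1 : 2 * B₀ * C₁ * B₃ * ε₁ ≤ ε₄) (h2 : 4 * ε₄ ≤ a₃) (h3 : 16 * B₀ * C₄ * ε₄ ≤ 1)
    (H₁ : ∀ r K (t : ℝ) s, GaugeField (P r K s) (jl r K s) SU2 → (ℬ r K s →L[ℂ] (𝒴 r K s)))
    (hH₁ : ∀ r K t s, ∀ V B, ‖H₁ r K t s V B‖ ≤ B₀ * ‖B‖)
    (Φ : ∀ r K (t : ℝ) s, GaugeField (P r K s) (jl r K s) SU2 → (Fin (m₀ r K s) → ℂ) → ℬ r K s) {rΦ : ℝ}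
    (hΦd : ∀ r K t s, ∀ V, DifferentiableOn ℂ (Φ r K t s V) (ball 0 rΦ)) (hΦ0 : ∀ r K t s, ∀ V, Φ r K t s V 0 = 0)
    (hΦ : ∀ r K t s, ∀ V, ∀ z ∈ ball (0 : Fin (m₀ r K s) → ℂ) rΦ, ‖Φ r K t s V z‖ < 2 * dL * C₁ * ε₁) (hSr : S < rΦ)
    -- ══ R11 SUPPLIED (row S99, γ14): the THREE Landau-correction letters ARE the tree's `C_k` of [B7] Prop. 4 in …
    (k : Bool → ℕ → σ → ℕ) (Sf Sf' Sw Sw' Se Se' : ∀ r K s, Finset (B7Prop1Explicit.Site (P r K s).d × Fin (P r K s).d))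
    (Ubg : ∀ r K (t : ℝ) s (τ : ι), GaugeField (P r K s) (jl r K s) SU2 → B7Prop1Explicit.Site (P r K s).d → Fin (P r K s).d →
      (𝔸 r K s)ˣ)
    (hUbg : ∀ r K t s τ, ∀ V x κ, Ubg r K t s τ V x κ ∈ unitaryUnits (𝔸 r K s)) {α₀ : ℝ} (hα : 0 < α₀)
    (hα3 : ∀ r K s, C0 (P r K s).d * α₀ ≤ 1 / 3) (hα4 : ∀ r K s, 4 * α₀ ≤ c2' (P r K s).d (P r K s).L)
    (hα6 : ∀ r K s, 4 * O1cov (P r K s).d * α₀ ≤ 1 / 3)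
    (h52locw : ∀ r K t s τ, ∀ V (c : ↥(Sw' r K s)), pdevOn (loK (P r K s).L (k r K s) c.1.1) (bondHiK (P r K s).L (k r K s)
      c.1.1 c.1.2) (Ubg r K t s τ V) < α₀ * ((((P r K s).L : ℝ) ^ k r K s)⁻¹) ^ 2)
    (h52loce : ∀ r K t s τ, ∀ V (c : ↥(Se' r K s)), pdevOn (loK (P r K s).L (k r K s) c.1.1) (bondHiK (P r K s).L (k r K s)
      c.1.1 c.1.2) (Ubg r K t s τ V) < α₀ * ((((P r K s).L : ℝ) ^ k r K s)⁻¹) ^ 2)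
    (ϖe₁ : ∀ r K (t : ℝ) s (τ : ι), ↥(Se r K s) → ℝ) (ϖe₂ : ∀ r K (t : ℝ) s (τ : ι), ↥(Se' r K s) → ℝ)
    (hϖe₁ : ∀ r K t s τ, ∀ b, 0 ≤ ϖe₁ r K t s τ b) (hϖe₂ : ∀ r K t s τ, ∀ c, 0 ≤ ϖe₂ r K t s τ c) {r₀e : ℝ}
    (hreache : ∀ r K t s τ, ∀ (c : ↥(Se' r K s)) (b : ↥(Se r K s)), BondIn (loK (P r K s).L (k r K s) c.1.1) (bondHiK (P r K
      s).L (k r K s) c.1.1 c.1.2) b.1.1 b.1.2 → ϖe₂ r K t s τ c - r₀e ≤ ϖe₁ r K t s τ b)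
    (ιs : ∀ r K (t : ℝ) s, GaugeField (P r K s) (jl r K s) SU2 → (𝒴 r K s →L[ℂ] (↥(Sf r K s) → 𝔸 r K s)))
    (hι : ∀ r K t s, ∀ V Y, ‖ιs r K t s V Y‖ ≤ ‖Y‖)
    (Hop : ∀ r K (t : ℝ) s, GaugeField (P r K s) (jl r K s) SU2 → ((↥(Sf' r K s) → 𝔸 r K s) →L[ℂ] (𝒴 r K s)))
    (hH : ∀ r K t s, ∀ V X, ‖Hop r K t s V X‖ ≤ B₀ * ‖X‖) {ε₃ : ℝ} (h18 : ∀ r K s, 18 * C2cov (P r K s).d * B₀ * ε₃ ≤ 1)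
    (hcoup : ε₄ + B₀ * (2 * dL * C₁ * ε₁) ≤ ε₃) (h3R : ∀ r K s, 3 * ε₃ ≤ landauRad (P r K s).d (P r K s).L)
    (ℓs : ∀ r K (t : ℝ) s, ιc r K s → List (𝒴 r K s →L[ℂ] Matrix n n ℂ)) {κr : Bool → ℕ → ℝ} (hκ : ∀ r K s, 0 ≤ κr r (jl r K s))
    (hℓ : ∀ r K t s, ∀ p ∈ Pu r K t s, ∀ ℓ ∈ ℓs r K t s p, ∀ Y, ‖ℓ Y‖ ≤ κr r (jl r K s) * ‖Y‖) {m : ℕ}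
    (hlen : ∀ r K t s, ∀ p ∈ Pu r K t s, (ℓs r K t s p).length ≤ m) {κc : Bool → ℕ → ℝ} (hκc : ∀ r K s, 0 ≤ κc r (jl r K s))
    (hcurl : ∀ r K t s, ∀ p ∈ Pu r K t s, ∀ Y, ‖((ℓs r K t s p).map fun ℓ => ℓ Y).sum‖ ≤ κc r (jl r K s) * ‖Y‖)
    -- ══ (T2) THE WILSON SLOT'S SUPPLIER DATA AT THE READING OF RECORD (file 4 …
    {Λw Λz Λb 𝔖 : Bool → ℕ → σ → Type*} [∀ r K s, Fintype (Λw r K s)] [∀ r K s, DecidableEq (Λw r K s)]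
    [∀ r K s, Fintype (Λz r K s)] [∀ r K s, Fintype (Λb r K s)] {𝔄w ℭ 𝔇 : Bool → ℕ → σ → Type*}
    [∀ r K s, NormedAddCommGroup (𝔄w r K s)] [∀ r K s, NormedSpace ℂ (𝔄w r K s)] [∀ r K s, CompleteSpace (𝔄w r K s)]
    [∀ r K s, NormedAddCommGroup (ℭ r K s)] [∀ r K s, NormedSpace ℂ (ℭ r K s)] [∀ r K s, NormedAddCommGroup (𝔇 r K s)]
    [∀ r K s, NormedSpace ℂ (𝔇 r K s)] {δw : ℝ} (hδw : 0 ≤ δw) (ϖw : ∀ r K (t : ℝ) s (τ : ι), 𝔖 r K s → ℝ)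
    (dis : ∀ r K (t : ℝ) s (τ : ι), 𝔖 r K s → 𝔖 r K s → ℝ)
    (hϖw : ∀ r K t s τ, ∀ x y, ϖw r K t s τ x ≤ ϖw r K t s τ y + dis r K t s τ x y)
    (pos : ∀ r K (t : ℝ) s (τ : ι), Λw r K s → 𝔖 r K s) (posz : ∀ r K (t : ℝ) s (τ : ι), Λz r K s → 𝔖 r K s)
    (pos' : ∀ r K (t : ℝ) s (τ : ι), ↥(Sw r K s) → 𝔖 r K s) (posx : ∀ r K (t : ℝ) s (τ : ι), ↥(Sw' r K s) → 𝔖 r K s)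
    (posb : ∀ r K (t : ℝ) s (τ : ι), Λb r K s → 𝔖 r K s)
    (k𝒢 : ∀ r K (t : ℝ) s (τ : ι), GaugeField (P r K s) (jl r K s) SU2 → Λw r K s → Λz r K s → (ℭ r K s →L[ℂ] (𝔄w r K s)))
    (kι : ∀ r K (t : ℝ) s (τ : ι), GaugeField (P r K s) (jl r K s) SU2 → ↥(Sw r K s) → Λw r K s → (𝔄w r K s →L[ℂ] (𝔸 r K s)))
    (kH : ∀ r K (t : ℝ) s (τ : ι), GaugeField (P r K s) (jl r K s) SU2 → Λw r K s → ↥(Sw' r K s) → (𝔸 r K s →L[ℂ] (𝔄w r K s)))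
    (kH₁ : ∀ r K (t : ℝ) s (τ : ι), GaugeField (P r K s) (jl r K s) SU2 → Λw r K s → Λb r K s → (𝔇 r K s →L[ℂ] (𝔄w r K s)))
    {c𝒢 δ𝒢 M𝒢 cι δι Mι cH δH MH cH₁ δH₁ MH₁ : ℝ} (hc𝒢 : 0 ≤ c𝒢) (hM𝒢 : 0 ≤ M𝒢)
    (hk𝒢 : ∀ r K t s τ, ∀ V c b', ‖k𝒢 r K t s τ V c b'‖ ≤ c𝒢 * Real.exp (-(δ𝒢 * dis r K t s τ (pos r K t s τ c) (posz r K t s τ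
      b'))))
    (hM𝒢' : ∀ r K t s τ, ∀ x, ∑ b', Real.exp (-((δ𝒢 - δw) * dis r K t s τ x (posz r K t s τ b'))) ≤ M𝒢) (hcι : 0 ≤ cι)
    (hMι : 0 ≤ Mι)
    (hkι : ∀ r K t s τ, ∀ V c b', ‖kι r K t s τ V c b'‖ ≤ cι * Real.exp (-(δι * dis r K t s τ (pos' r K t s τ c) (pos r K t s τ
      b'))))
    (hMι' : ∀ r K t s τ, ∀ x, ∑ b', Real.exp (-((δι - δw) * dis r K t s τ x (pos r K t s τ b'))) ≤ Mι) (hcH : 0 ≤ cH)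
    (hMH : 0 ≤ MH)
    (hkH : ∀ r K t s τ, ∀ V c b', ‖kH r K t s τ V c b'‖ ≤ cH * Real.exp (-(δH * dis r K t s τ (pos r K t s τ c) (posx r K t s τ
      b'))))
    (hMH' : ∀ r K t s τ, ∀ x, ∑ b', Real.exp (-((δH - δw) * dis r K t s τ x (posx r K t s τ b'))) ≤ MH) (hcH₁ : 0 ≤ cH₁)
    (hMH₁ : 0 ≤ MH₁)
    (hkH₁ : ∀ r K t s τ, ∀ V c b', ‖kH₁ r K t s τ V c b'‖ ≤ cH₁ * Real.exp (-(δH₁ * dis r K t s τ (pos r K t s τ c) (posb r K t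
      s τ b'))))
    (hMH₁' : ∀ r K t s τ, ∀ x, ∑ b', Real.exp (-((δH₁ - δw) * dis r K t s τ x (posb r K t s τ b'))) ≤ MH₁)
    -- the flat lists (P2)∕(P4)∕(118)∕(121)∕(103)∕(75)-TYPE∕(44) at radius `RCw` with `6(ε₄w + B₀w·bw) ≤ RCw`∕scal …
    (W𝒱w : ∀ r K (t : ℝ) s (τ : ι), GaugeField (P r K s) (jl r K s) SU2 → (Λw r K s → 𝔄w r K s) → (Λz r K s → ℭ r K s))
    {B₀w C₄w a₃w ε₄w bw : ℝ} (h𝒢w : ∀ r K t s τ, ∀ V f, ‖kerOp (k𝒢 r K t s τ V) f‖ ≤ B₀w * ‖f‖)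
    (hWw : ∀ r K t s τ, ∀ V, Prop4Hyp (W𝒱w r K t s τ V) C₄w a₃w) (hB₀w : 0 < B₀w) (hC₄w : 0 ≤ C₄w) (hε₄w : 0 ≤ ε₄w)
    (hdomw : 2 * (ε₄w + B₀w * bw) ≤ a₃w) (hselfw : B₀w * C₄w * (ε₄w + B₀w * bw) ^ 2 ≤ ε₄w)
    (hcontrw : 4 * B₀w * C₄w * (ε₄w + B₀w * bw) < 1) (hH₁w : ∀ r K t s τ, ∀ V B, ‖kerOp (kH₁ r K t s τ V) B‖ ≤ B₀w * ‖B‖)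
    (Φw : ∀ r K (t : ℝ) s (τ : ι), GaugeField (P r K s) (jl r K s) SU2 → (Fin (m₀ r K s) → ℂ) → (Λb r K s → 𝔇 r K s)) {rΦw : ℝ}
    (hΦdw : ∀ r K t s τ, ∀ V, DifferentiableOn ℂ (Φw r K t s τ V) (ball 0 rΦw)) (hΦ0w : ∀ r K t s τ, ∀ V, Φw r K t s τ V 0 = 0)
    (hΦbw : ∀ r K t s τ, ∀ V, ∀ z ∈ ball (0 : Fin (m₀ r K s) → ℂ) rΦw, ‖Φw r K t s τ V z‖ < bw) (h2Sw : 2 * S ≤ rΦw)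
    (hιw : ∀ r K t s τ, ∀ V Y, ‖kerOp (kι r K t s τ V) Y‖ ≤ ‖Y‖)
    (hHw : ∀ r K t s τ, ∀ V X, ‖kerOp (kH r K t s τ V) X‖ ≤ B₀w * ‖X‖)
    (hqw : ∀ r K s, 9 * C2cov (P r K s).d * B₀w * (ε₄w + B₀w * bw) < 1)
    (hRCw : ∀ r K s, 6 * (ε₄w + B₀w * bw) ≤ landauRad (P r K s).d (P r K s).L)
    -- localities with reaches, the block support, the two contraction numbers (DISPLAYED arithmetic on the decay …
    (NW : ∀ r K (t : ℝ) s (τ : ι), Λz r K s → Λw r K s → Prop)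
    (hlocW : ∀ r K t s τ, ∀ V, ∀ A A' : Λw r K s → 𝔄w r K s, ∀ c', (∀ b', NW r K t s τ c' b' → A b' = A' b') → W𝒱w r K t s τ V A
      c' = W𝒱w r K t s τ V A' c')
    {rW : ℝ}
    (hreachW : ∀ r K t s τ, ∀ c' b', NW r K t s τ c' b' → ϖw r K t s τ (posz r K t s τ c') - rW ≤ ϖw r K t s τ (pos r K t s τ
      b'))
    {rC : ℝ}
    (hreachC : ∀ r K t s τ, ∀ (c' : ↥(Sw' r K s)) (b' : ↥(Sw r K s)), BondIn (loK (P r K s).L (k r K s) c'.1.1) (bondHiK (P r K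
      s).L (k r K s) c'.1.1 c'.1.2) b'.1.1 b'.1.2 → ϖw r K t s τ (posx r K t s τ c') - rC ≤ ϖw r K t s τ (pos' r K t s τ b'))
    (hsupp : ∀ r K t s τ, ∀ V, ∀ z : Fin (m₀ r K s) → ℂ, ∀ i, 0 < ϖw r K t s τ (posb r K t s τ i) → Φw r K t s τ V z i = 0)
    (hqW : c𝒢 * M𝒢 * (2 * C₄w * a₃w * Real.exp (δw * rW)) < 1)
    (hk : ∀ r K s, 2 * C2cov (P r K s).d * landauRad (P r K s).d (P r K s).L * Real.exp (δw * rC) * (cι * Mι) * (cH * MH) < 1)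
    -- weight plaquettes; read-outs BLIND off located supports, FLAT op-norms, curl op-norm (DISPLAYED; `κ_c ∝ η²` …
    {𝔭 : Bool → ℕ → σ → Type*} (Pw : ∀ r K (t : ℝ) s (τ : ι), Finset (𝔭 r K s))
    (ℓw : ∀ r K (t : ℝ) s (τ : ι), 𝔭 r K s → List ((Λw r K s → 𝔄w r K s) →L[ℂ] Matrix n n ℂ))
    (suppw : ∀ r K (t : ℝ) s (τ : ι), 𝔭 r K s → Finset (Λw r K s)) (ϖPw : ∀ r K (t : ℝ) s (τ : ι), 𝔭 r K s → ℝ)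
    (hblindw : ∀ r K t s τ, ∀ p ∈ Pw r K t s τ, ∀ ℓ ∈ ℓw r K t s τ p, ∀ A A' : Λw r K s → 𝔄w r K s, (∀ b' ∈ suppw r K t s τ p, A
      b' = A' b') → ℓ A = ℓ A')
    (hdepthw : ∀ r K t s τ, ∀ p ∈ Pw r K t s τ, ∀ b' ∈ suppw r K t s τ p, ϖPw r K t s τ p ≤ ϖw r K t s τ (pos r K t s τ b'))
    (hϖPw : ∀ r K t s τ, ∀ p ∈ Pw r K t s τ, 0 ≤ ϖPw r K t s τ p) {κwb κcb : Bool → ℕ → ℝ}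
    (hκwb : ∀ r K s, 0 ≤ κwb r (jl r K s)) (hκcb : ∀ r K s, 0 ≤ κcb r (jl r K s))
    (hℓwb : ∀ r K t s τ, ∀ p ∈ Pw r K t s τ, ∀ ℓ ∈ ℓw r K t s τ p, ‖ℓ‖ ≤ κwb r (jl r K s))
    (hcurlw : ∀ r K t s τ, ∀ p ∈ Pw r K t s τ, ‖(ℓw r K t s τ p).sum‖ ≤ κcb r (jl r K s)) {mw : ℕ}
    (hlenw : ∀ r K t s τ, ∀ p ∈ Pw r K t s τ, (ℓw r K t s τ p).length ≤ mw)
    -- the global tuple's real structure with SKEW weight read-outs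
    (𝓡𝒴w : ∀ r K (t : ℝ) s (τ : ι), AddSubgroup (Λw r K s → 𝔄w r K s))
    (h𝓡𝒴w : ∀ r K t s τ, IsClosed (𝓡𝒴w r K t s τ : Set (Λw r K s → 𝔄w r K s)))
    (𝓡𝒵w : ∀ r K (t : ℝ) s (τ : ι), AddSubgroup (Λz r K s → ℭ r K s))
    (𝓡ℬw : ∀ r K (t : ℝ) s (τ : ι), AddSubgroup (Λb r K s → 𝔇 r K s))
    (h𝒢rw : ∀ r K t s τ, ∀ V, ∀ f ∈ 𝓡𝒵w r K t s τ, kerOp (k𝒢 r K t s τ V) f ∈ 𝓡𝒴w r K t s τ)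
    (hWrw : ∀ r K t s τ, ∀ V, ∀ Y ∈ 𝓡𝒴w r K t s τ, W𝒱w r K t s τ V Y ∈ 𝓡𝒵w r K t s τ)
    (hιrw : ∀ r K t s τ, ∀ V, ∀ Y ∈ 𝓡𝒴w r K t s τ, kerOp (kι r K t s τ V) Y ∈ skewPi ↥(Sw r K s))
    (hHrw : ∀ r K t s τ, ∀ V, ∀ X ∈ skewPi (𝔸 := 𝔸 r K s) ↥(Sw' r K s), kerOp (kH r K t s τ V) X ∈ 𝓡𝒴w r K t s τ)
    (hH₁rw : ∀ r K t s τ, ∀ V, ∀ B ∈ 𝓡ℬw r K t s τ, kerOp (kH₁ r K t s τ V) B ∈ 𝓡𝒴w r K t s τ)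
    (hΦrw : ∀ r K t s τ, ∀ V, ∀ y : Fin (m₀ r K s) → ℝ, ‖y‖ ≤ S → Φw r K t s τ V (cplx y) ∈ 𝓡ℬw r K t s τ)
    (hskew : ∀ r K t s τ, ∀ p ∈ Pw r K t s τ, ∀ ℓ ∈ ℓw r K t s τ p, ∀ Y ∈ 𝓡𝒴w r K t s τ, ℓ Y ∈ skewAdjoint (Matrix n n ℂ))
    -- the frozen background plaquettes (N-ne7cp1-g31-2) with a uniform size bound, the located count, `0 ≤ β`
    (Bp : ∀ r K (t : ℝ) s (τ : ι), GaugeField (P r K s) (jl r K s) SU2 → 𝔭 r K s → Matrix n n ℂ)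
    {d : ∀ r K (t : ℝ) s (τ : ι), 𝔭 r K s → ℝ} {dbar : Bool → ℕ → ℝ}
    (hBu : ∀ r K t s τ, ∀ V, ∀ p ∈ Pw r K t s τ, Bp r K t s τ V p ∈ unitary (Matrix n n ℂ))
    (hBd : ∀ r K t s τ, ∀ V, ∀ p ∈ Pw r K t s τ, ‖Bp r K t s τ V p - 1‖ ≤ d r K t s τ p)
    (hd : ∀ r K t s τ, ∀ p ∈ Pw r K t s τ, d r K t s τ p ≤ dbar r (jl r K s)) (hdbar : ∀ r K s, 0 ≤ dbar r (jl r K s))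
    {Kw : Bool → ℕ → ℝ} (hKw : ∀ r K t s τ, ∑ p ∈ Pw r K t s τ, Real.exp (-(δw * ϖPw r K t s τ p)) ≤ Kw r (jl r K s))
    -- ══ (T3) THE LOCATED NON-WILSON TERMS' SUPPLIER DATA (S71 f2 `hE_landau_chartRay_pinned`): the global tuple' …
    {Λe : Bool → ℕ → σ → Type*} [∀ r K s, Fintype (Λe r K s)] {𝔄 : Bool → ℕ → σ → Type*} [∀ r K s, NormedAddCommGroup (𝔄 r K s)]
    [∀ r K s, NormedSpace ℂ (𝔄 r K s)] [∀ r K s, CompleteSpace (𝔄 r K s)] {δ' : ℝ} {ϖ : ∀ r K (t : ℝ) s (τ : ι), Λe r K s → ℝ}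
    (hδ' : 0 ≤ δ') (hϖ : ∀ r K t s τ, ∀ b', 0 ≤ ϖ r K t s τ b') {𝒵e ℬe : Bool → ℕ → σ → Type*}
    [∀ r K s, NormedAddCommGroup (𝒵e r K s)] [∀ r K s, NormedSpace ℂ (𝒵e r K s)] [∀ r K s, NormedAddCommGroup (ℬe r K s)]
    [∀ r K s, NormedSpace ℂ (ℬe r K s)]
    (𝒢e : ∀ r K t s (τ : ι), GaugeField (P r K s) (jl r K s) SU2 → (𝒵e r K s →L[ℂ] WSup (pinW δ' (ϖ r K t s τ)) 1 (𝔄 r K s)))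
    (W𝒱e : ∀ r K t s (τ : ι), GaugeField (P r K s) (jl r K s) SU2 → WSup (pinW δ' (ϖ r K t s τ)) 1 (𝔄 r K s) → 𝒵e r K s)
    {B₀e C₄e a₃e be ε₄e : ℝ} (h𝒢e : ∀ r K t s τ, ∀ V f, ‖𝒢e r K t s τ V f‖ ≤ B₀e * ‖f‖)
    (hWe : ∀ r K t s τ, ∀ V, Prop4Hyp (W𝒱e r K t s τ V) C₄e a₃e) (hB₀e : 0 < B₀e) (hC₄e : 0 ≤ C₄e) (hbe : 0 ≤ be)
    (hε₄e : 0 ≤ ε₄e) (hdome : 2 * (ε₄e + B₀e * be) ≤ a₃e) (hselfe : B₀e * C₄e * (ε₄e + B₀e * be) ^ 2 ≤ ε₄e)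
    (hcontre : 4 * B₀e * C₄e * (ε₄e + B₀e * be) < 1)
    (H₁e : ∀ r K t s (τ : ι), GaugeField (P r K s) (jl r K s) SU2 → (ℬe r K s →L[ℂ] WSup (pinW δ' (ϖ r K t s τ)) 1 (𝔄 r K s)))
    (hH₁e : ∀ r K t s τ, ∀ V B, ‖H₁e r K t s τ V B‖ ≤ B₀e * ‖B‖)
    (Φe : ∀ r K (t : ℝ) s (τ : ι), GaugeField (P r K s) (jl r K s) SU2 → (Fin (m₀ r K s) → ℂ) → ℬe r K s) {rΦe : ℝ}
    (hΦde : ∀ r K t s τ, ∀ V, DifferentiableOn ℂ (Φe r K t s τ V) (ball 0 rΦe)) (hΦ0e : ∀ r K t s τ, ∀ V, Φe r K t s τ V 0 = 0)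
    (hΦbe : ∀ r K t s τ, ∀ V, ∀ z ∈ ball (0 : Fin (m₀ r K s) → ℂ) rΦe, ‖Φe r K t s τ V z‖ < be) (hSre : S < rΦe)
    (ιe : ∀ r K t s (τ : ι), GaugeField (P r K s) (jl r K s) SU2 → (WSup (pinW δ' (ϖ r K t s τ)) 1 (𝔄 r K s) →L[ℂ] WSup (pinW δ'
      (ϖe₁ r K t s τ)) 1 (𝔸 r K s)))
    (hιe : ∀ r K t s τ, ∀ V Y, ‖ιe r K t s τ V Y‖ ≤ ‖Y‖)
    (He : ∀ r K t s (τ : ι), GaugeField (P r K s) (jl r K s) SU2 → (WSup (pinW δ' (ϖe₂ r K t s τ)) 1 (𝔸 r K s) →L[ℂ] WSup (pinW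
      δ' (ϖ r K t s τ)) 1 (𝔄 r K s)))
    (hHe : ∀ r K t s τ, ∀ V X, ‖He r K t s τ V X‖ ≤ B₀e * ‖X‖)
    (hqe : ∀ r K s, 9 * (C2cov (P r K s).d * Real.exp (2 * δ' * r₀e)) * B₀e * (ε₄e + B₀e * be) < 1)
    (hRCe : ∀ r K s, 3 * (ε₄e + B₀e * be) ≤ landauRad (P r K s).d (P r K s).L) {𝔱 : Bool → ℕ → σ → Type*}
    (I : ∀ r K (t : ℝ) s (τ : ι), Finset (𝔱 r K s)) {Ef : ∀ r K (t : ℝ) s (τ : ι), 𝔱 r K s → (Λe r K s → 𝔄 r K s) → ℂ} {rE : ℝ}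
    {ee : ∀ r K (t : ℝ) s (τ : ι), 𝔱 r K s → ℝ} (hrE : 0 < rE)
    (hEd : ∀ r K t s τ, ∀ i ∈ I r K t s τ, DifferentiableOn ℂ (Ef r K t s τ i) (ball 0 rE))
    (hEb : ∀ r K t s τ, ∀ i ∈ I r K t s τ, ∀ Z ∈ ball (0 : Λe r K s → 𝔄 r K s) rE, ‖Ef r K t s τ i Z‖ ≤ ee r K t s τ i)
    (he0 : ∀ r K t s τ, ∀ i ∈ I r K t s τ, 0 ≤ ee r K t s τ i) (supp : ∀ r K (t : ℝ) s (τ : ι), 𝔱 r K s → Finset (Λe r K s))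
    (hblind : ∀ r K t s τ, ∀ i ∈ I r K t s τ, ∀ A₁ A₂ : Λe r K s → 𝔄 r K s, (∀ b' ∈ supp r K t s τ i, A₁ b' = A₂ b') → Ef r K t
      s τ i A₁ = Ef r K t s τ i A₂)
    (ϖP : ∀ r K (t : ℝ) s (τ : ι), 𝔱 r K s → ℝ)
    (hdepth : ∀ r K t s τ, ∀ i ∈ I r K t s τ, ∀ b' ∈ supp r K t s τ i, ϖP r K t s τ i ≤ ϖ r K t s τ b') {LK : ℝ} (hLK : 0 ≤ LK)
    (hK : ∀ r K t s τ, ∑ i ∈ I r K t s τ, 2 * ee r K t s τ i / rE * Real.exp (-(δ' * ϖP r K t s τ i)) ≤ LK)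
    (hcoupE : ∀ r K s, ((ε₄e + B₀e * be) + B₀e * (4 * (C2cov (P r K s).d * Real.exp (2 * δ' * r₀e)) * (ε₄e + B₀e * be) ^ 2)) ≤
      rE / 2)
    {BE₁ : ℝ}
    (hElb₁ : ∀ r K t s τ, ∀ V (y : Fin (m₀ r K s) → ℝ), ‖y‖ ≤ S → -BE₁ ≤ (∑ i ∈ I r K t s τ, Ef r K t s τ i (WSup.toPiL (𝔄 := 𝔄
      r K s) (pinW δ' (ϖ r K t s τ)) 1 (landauExp (fun Y : WSup (pinW δ' (ϖe₁ r K t s τ)) 1 (𝔸 r K s) => ((toPiL (pinW δ' (ϖe₂ r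
      K t s τ)) 1).symm (landauCf (P r K s).L (Ubg r K t s τ V) (k r K s) (Se r K s) (Se' r K s) (toPiL (pinW δ' (ϖe₁ r K t s
      τ)) 1 Y)) : WSup (pinW δ' (ϖe₂ r K t s τ)) 1 (𝔸 r K s))) (ιe r K t s τ V) (He r K t s τ V) (4 * (C2cov (P r K s).d *
      Real.exp (2 * δ' * r₀e)) * (ε₄e + B₀e * be) ^ 2) (solAt (𝒢e r K t s τ V) 0 (W𝒱e r K t s τ V) ε₄e (0 : 𝒵e r K s) (H₁e r K t
      s τ V (Φe r K t s τ V (cplx y))) + H₁e r K t s τ V (Φe r K t s τ V (cplx y)))))).re)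
    -- ══ (S78) THE FLUCTUATION-DRESSED TERMS: `−log ∫ g e^{A} dμ` with an ω-UNIFORM ray constant `B_d`, integrabi …
    {Ω : Bool → ℕ → σ → Type*} [∀ r K s, MeasurableSpace (Ω r K s)] (μ : ∀ r K (t : ℝ) s (τ : ι), Measure (Ω r K s))
    {g : ∀ r K (t : ℝ) s (τ : ι), Ω r K s → ℝ} (hg : ∀ r K t s τ, ∀ ω, 0 ≤ g r K t s τ ω)
    (Aex : ∀ r K (t : ℝ) s (τ : ι), GaugeField (P r K s) (jl r K s) SU2 → (Fin (m₀ r K s) → ℝ) → Ω r K s → ℝ) {Bd : ℝ}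
    (hBd0 : 0 ≤ Bd)
    (hint : ∀ r K t s τ, ∀ V, ∀ x ∈ W r K t s τ V, ∀ c : ℝ, 1 / 2 ≤ c → c ≤ 1 → Integrable (fun ω => g r K t s τ ω * Real.exp
      (Aex r K t s τ V (c • x) ω)) (μ r K t s τ))
    (hpos : ∀ r K t s τ, ∀ V, ∀ x ∈ W r K t s τ V, ∀ c : ℝ, 1 / 2 ≤ c → c ≤ 1 → 0 < ∫ ω, g r K t s τ ω * Real.exp (Aex r K t s τ
      V (c • x) ω) ∂(μ r K t s τ))
    (hA : ∀ r K t s τ, ∀ V, ∀ x ∈ W r K t s τ V, ∀ c : ℝ, 1 / 2 ≤ c → c ≤ 1 → ∀ ω, Aex r K t s τ V x ω ≤ Aex r K t s τ V (c • x)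
      ω + (1 - c) * Bd)
    {BE₂ : ℝ}
    (hElb₂ : ∀ r K t s τ, ∀ V (y : Fin (m₀ r K s) → ℝ), ‖y‖ ≤ S → -BE₂ ≤ (-Real.log (∫ ω, g r K t s τ ω * Real.exp (Aex r K t s
      τ V y ω) ∂(μ r K t s τ))))
    (L : ∀ r K (t : ℝ) s, Set (𝒴 r K s →L[ℂ] Matrix n n ℂ)) (𝓡𝒵 : ∀ r K (t : ℝ) s, AddSubgroup (𝒵 r K s))
    (𝓡ℬ : ∀ r K (t : ℝ) s, AddSubgroup (ℬ r K s))
    (h𝒢r : ∀ r K t s, ∀ V, ∀ f ∈ 𝓡𝒵 r K t s, 𝒢 r K t s V f ∈ readOutReal (L r K t s))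
    (hWr : ∀ r K t s, ∀ V, ∀ Y ∈ readOutReal (L r K t s), W𝒱 r K t s V Y ∈ 𝓡𝒵 r K t s)
    (hιr : ∀ r K t s, ∀ V, ∀ Y ∈ readOutReal (L r K t s), ιs r K t s V Y ∈ skewPi ↥(Sf r K s))
    (hHr : ∀ r K t s, ∀ V, ∀ X ∈ skewPi (𝔸 := 𝔸 r K s) ↥(Sf' r K s), Hop r K t s V X ∈ readOutReal (L r K t s))
    (hH₁r : ∀ r K t s, ∀ V, ∀ B ∈ 𝓡ℬ r K t s, H₁ r K t s V B ∈ readOutReal (L r K t s))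
    (hΦr : ∀ r K t s, ∀ V, ∀ y : Fin (m₀ r K s) → ℝ, ‖y‖ ≤ S → Φ r K t s V (cplx y) ∈ 𝓡ℬ r K t s)
    (hRdict : ∀ r K t s τ, ∀ V, ∀ x ∈ cube (m₀ r K s) S, F r K t s τ (fixTo (combBonds (lo r K s) (hi r K s)) 1 (updateFinset V
      (Λ r K s) (expFibreChart (Λ r K s) 1 (e r K s) x))) = Jco r K t s τ V x * ENNReal.ofReal (Real.exp (-((∑ p ∈ Pw r K t s τ,
      β r (jl r K s) * (1 - (Matrix.trace (Bp r K t s τ V p * holOf (ℓw r K t s τ p) (fun y => landauExp (landauCfBox (P r K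
      s).L (Ubg r K t s τ V) (k r K s) (Sw r K s) (Sw' r K s) (landauRad (P r K s).d (P r K s).L)) (kerOp (kι r K t s τ V))
      (kerOp (kH r K t s τ V)) (4 * C2cov (P r K s).d * (ε₄w + B₀w * bw) ^ 2) (solAt (kerOp (k𝒢 r K t s τ V)) 0 (W𝒱w r K t s τ
      V) ε₄w (0 : Λz r K s → ℭ r K s) (kerOp (kH₁ r K t s τ V) (Φw r K t s τ V (cplx y))) + kerOp (kH₁ r K t s τ V) (Φw r K t s
      τ V (cplx y)))) x)).re / Fintype.card n)) + ((∑ i ∈ I r K t s τ, Ef r K t s τ i (WSup.toPiL (𝔄 := 𝔄 r K s) (pinW δ' (ϖ r K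
      t s τ)) 1 (landauExp (fun Y : WSup (pinW δ' (ϖe₁ r K t s τ)) 1 (𝔸 r K s) => ((toPiL (pinW δ' (ϖe₂ r K t s τ)) 1).symm
      (landauCf (P r K s).L (Ubg r K t s τ V) (k r K s) (Se r K s) (Se' r K s) (toPiL (pinW δ' (ϖe₁ r K t s τ)) 1 Y)) : WSup
      (pinW δ' (ϖe₂ r K t s τ)) 1 (𝔸 r K s))) (ιe r K t s τ V) (He r K t s τ V) (4 * (C2cov (P r K s).d * Real.exp (2 * δ' *
      r₀e)) * (ε₄e + B₀e * be) ^ 2) (solAt (𝒢e r K t s τ V) 0 (W𝒱e r K t s τ V) ε₄e (0 : 𝒵e r K s) (H₁e r K t s τ V (Φe r K t s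
      τ V (cplx x))) + H₁e r K t s τ V (Φe r K t s τ V (cplx x)))))).re + (-Real.log (∫ ω, g r K t s τ ω * Real.exp (Aex r K t s
      τ V x ω) ∂(μ r K t s τ))))))))
    (hudict : ∀ r K t s, ∀ V, ∀ x ∈ cube (m₀ r K s) S, u r K t s (fixTo (combBonds (lo r K s) (hi r K s)) 1 (updateFinset V (Λ r
      K s) (expFibreChart (Λ r K s) 1 (e r K s) x))) = classifier (hPu r K t s) (fun p => holOf (ℓs r K t s p) (fun y =>
      landauExp ((ball (0 : ↥(Sf r K s) → 𝔸 r K s) (landauRad (P r K s).d (P r K s).L)).indicator (landauCf (P r K s).L (1 :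
      B7Prop1Explicit.Site (P r K s).d → Fin (P r K s).d → (𝔸 r K s)ˣ) (k r K s) (Sf r K s) (Sf' r K s))) (ιs r K t s V) (Hop r
      K t s V) (4 * C2cov (P r K s).d * (ε₄ + B₀ * (2 * dL * C₁ * ε₁)) ^ 2) (solAt (𝒢 r K t s V) 0 (W𝒱 r K t s V) ε₄ (0 : 𝒵 r K
      s) (H₁ r K t s V (Φ r K t s V (cplx y))) + H₁ r K t s V (Φ r K t s V (cplx y))))) x)
    (hJW : ∀ r K t s τ, ∀ V x, Jco r K t s τ V x ≠ 0 → x ∈ W r K t s τ V)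
    (hJ : ∀ r K t s τ, ∀ V x, ∀ a : ℝ, 0 ≤ a → Jco r K t s τ V x ≤ Jco r K t s τ V (Real.exp (-a) • x))
    (hJ1 : ∀ r K t s τ, ∀ V x, Jco r K t s τ V x ≤ 1)
    (hWS : ∀ r K t s τ, ∀ V, W r K t s τ V ⊆ closedBall (0 : Fin (m₀ r K s) → ℝ) S) (hδ0 : 0 ≤ δ) (hδ1 : δ < 1)
    -- SM-L2 (SM) DISCHARGED IN THE STOKES CURRENCY (S73 `hSM_of_stokes`): the η-scalings of the classifier's read …
    {c₁ c₂ zs : ℝ}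
    (hs₁ : ∀ r K s, κc r (jl r K s) * ((ε₄ + B₀ * (2 * dL * C₁ * ε₁)) + B₀ * (4 * C2cov (P r K s).d * (ε₄ + B₀ * (2 * dL * C₁ *
      ε₁)) ^ 2)) ≤ c₁ * η r (jl r K s) ^ 2 * zs)
    (ha : ∀ r K s, κr r (jl r K s) * ((ε₄ + B₀ * (2 * dL * C₁ * ε₁)) + B₀ * (4 * C2cov (P r K s).d * (ε₄ + B₀ * (2 * dL * C₁ *
      ε₁)) ^ 2)) ≤ c₂ * η r (jl r K s) * zs)
    (hma : ∀ r K s, m * (κr r (jl r K s) * ((ε₄ + B₀ * (2 * dL * C₁ * ε₁)) + B₀ * (4 * C2cov (P r K s).d * (ε₄ + B₀ * (2 * dL *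
      C₁ * ε₁)) ^ 2))) ≤ 1)
    (hsm : ∀ r K s, 36 * (c₁ * zs + m ^ 2 * c₂ ^ 2 * zs ^ 2) / (rΦ / S - 1) ^ 2 ≤ δ * ε r (K - lvl r K s))
    -- THE DISPLAYED γ3 INPUT OF RECORD (N-ne7cp1-g32-2 ∕ N-ne7cp1-g33-2 «COLLAR»; leaf-01-g8 l.18489, leaf-08-g14 …
    {a : ℝ} (ha0 : 0 ≤ a) (hrad : ∀ r K s, (((P r K s).d - 1 : ℕ) : ℝ) * nb r K s * a ≤ 2 * Real.sin (S / 2))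
    {Pcore : ∀ r K (t : ℝ) s, Set (Plaq (P r K s) (jl r K s))}
    {Pcollar : ∀ r K (t : ℝ) s (τ : ι), Set (Plaq (P r K s) (jl r K s))}
    (hcover : ∀ r K t s τ, boxPlaqs (lo r K s) (hi r K s) ⊆ Pcore r K t s ∪ (Pcollar r K t s τ))
    (hcore : ∀ r K t s, ∀ (V : GaugeField (P r K s) (jl r K s) SU2) (y : ↥(Λ r K s) → SU2), u r K t s (fixTo (combBonds (lo r K
      s) (hi r K s)) 1 (updateFinset V (Λ r K s) y)) < ε r (K - lvl r K s) * η r (jl r K s) ^ 2 → PlaqSmallOn (Pcore r K t s) a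
      (fixTo (combBonds (lo r K s) (hi r K s)) 1 (updateFinset V (Λ r K s) y)))
    (hcollar : ∀ r K t s τ, ∀ (V : GaugeField (P r K s) (jl r K s) SU2) (y : ↥(Λ r K s) → SU2), F r K t s τ (fixTo (combBonds
      (lo r K s) (hi r K s)) 1 (updateFinset V (Λ r K s) y)) ≠ 0 → PlaqSmallOn (Pcollar r K t s τ) a (fixTo (combBonds (lo r K
      s) (hi r K s)) 1 (updateFinset V (Λ r K s) y)))
    (hρ : ∀ r j, ρ r j ≤ (1 - δ) / 2) (hβ : ∀ r j, 0 ≤ β r j)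
    :
    ∀ (r : Bool) (K : ℕ) (t : ℝ) (s : σ) (τ : ι), SlotAntiConcentration ((fieldMeasure (P r K s) (jl r K s) SU2).withDensity ({U
      | u r K t s U < ε r (K - lvl r K s) * η r (jl r K s) ^ 2}.indicator (F r K t s τ))) (fun U => u r K t s U / η r (jl r K s)
      ^ 2) (ε r (K - lvl r K s)) (ρ r (lvl r K s)) (2 * ((m₀ r K s : ℝ) + (3 * (|β r (jl r K s)| * ((dbar r (jl r K s) + 2 *
      (κcb r (jl r K s) * (cH₁ * MH₁ * bw / ((1 - c𝒢 * M𝒢 * (2 * C₄w * a₃w * Real.exp (δw * rW))) * (1 - 2 * C2cov (P r K s).d *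
      landauRad (P r K s).d (P r K s).L * Real.exp (δw * rC) * (cι * Mι) * (cH * MH)))) + expTail₂ (mw * (κwb r (jl r K s) *
      (cH₁ * MH₁ * bw / ((1 - c𝒢 * M𝒢 * (2 * C₄w * a₃w * Real.exp (δw * rW))) * (1 - 2 * C2cov (P r K s).d * landauRad (P r K
      s).d (P r K s).L * Real.exp (δw * rC) * (cι * Mι) * (cH * MH))))))) / (rΦw / S)) * (2 * (κcb r (jl r K s) * (cH₁ * MH₁ *
      bw / ((1 - c𝒢 * M𝒢 * (2 * C₄w * a₃w * Real.exp (δw * rW))) * (1 - 2 * C2cov (P r K s).d * landauRad (P r K s).d (P r K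
      s).L * Real.exp (δw * rC) * (cι * Mι) * (cH * MH)))) + expTail₂ (mw * (κwb r (jl r K s) * (cH₁ * MH₁ * bw / ((1 - c𝒢 * M𝒢
      * (2 * C₄w * a₃w * Real.exp (δw * rW))) * (1 - 2 * C2cov (P r K s).d * landauRad (P r K s).d (P r K s).L * Real.exp (δw *
      rC) * (cι * Mι) * (cH * MH))))))) / (rΦw / S))) * Kw r (jl r K s)) + (3 * (LK * (2 * ((ε₄e + B₀e * be) + B₀e * (4 * (C2cov
      (P r K s).d * Real.exp (2 * δ' * r₀e)) * (ε₄e + B₀e * be) ^ 2)))) / (rΦe / S - 1) + Bd))) / (1 - δ)) :=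
  fun r K t s τ => slotAntiConcentration_thresholdUnits (hη r (jl r K s))
    (slotAC_realized_su2_landauChart_assembled_decay_cfB7_kept (hn r K s) (hN r K s) (Λ r K s) (hΛbox r K s) (hΛcomb r K s) (e r
      K s) hS hSπ (hF r K t s τ) (hFi r K t s τ) (hu r K t s) (hui r K t s) (hPu r K t s) (W r K t s τ) (Jco r K t s τ) (𝒢 r K t
      s) (W𝒱 r K t s) (h𝒢 r K t s) (hW r K t s) hB₀ hC₄ hε₄ hdL hC₁ hε₁ hB₃ h1 h2 h3 (H₁ r K t s) (hH₁ r K t s) (Φ r K t s) (hΦd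
      r K t s) (hΦ0 r K t s) (hΦ r K t s) hSr (k r K s) (Sf r K s) (Sf' r K s) (Sw r K s) (Sw' r K s) (Se r K s) (Se' r K s)
      (Ubg r K t s τ) (hUbg r K t s τ) hα (hα3 r K s) (hα4 r K s) (hα6 r K s) (h52locw r K t s τ) (h52loce r K t s τ) (ϖe₁ r K t
      s τ) (ϖe₂ r K t s τ) (hϖe₁ r K t s τ) (hϖe₂ r K t s τ) (hreache r K t s τ) (ιs r K t s) (hι r K t s) (Hop r K t s) (hH r K
      t s) (h18 r K s) hcoup (h3R r K s) (ℓs r K t s) (hκ r K s) (hℓ r K t s) (hlen r K t s) (hκc r K s) (hcurl r K t s) hδw (ϖw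
      r K t s τ) (dis r K t s τ) (hϖw r K t s τ) (pos r K t s τ) (posz r K t s τ) (pos' r K t s τ) (posx r K t s τ) (posb r K t
      s τ) (k𝒢 r K t s τ) (kι r K t s τ) (kH r K t s τ) (kH₁ r K t s τ) hc𝒢 hM𝒢 (hk𝒢 r K t s τ) (hM𝒢' r K t s τ) hcι hMι (hkι r
      K t s τ) (hMι' r K t s τ) hcH hMH (hkH r K t s τ) (hMH' r K t s τ) hcH₁ hMH₁ (hkH₁ r K t s τ) (hMH₁' r K t s τ) (W𝒱w r K t
      s τ) (h𝒢w r K t s τ) (hWw r K t s τ) hB₀w hC₄w hε₄w hdomw hselfw hcontrw (hH₁w r K t s τ) (Φw r K t s τ) (hΦdw r K t s τ)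
      (hΦ0w r K t s τ) (hΦbw r K t s τ) h2Sw (hιw r K t s τ) (hHw r K t s τ) (hqw r K s) (hRCw r K s) (NW r K t s τ) (hlocW r K
      t s τ) (hreachW r K t s τ) (hreachC r K t s τ) (hsupp r K t s τ) hqW (hk r K s) (Pw r K t s τ) (ℓw r K t s τ) (suppw r K t
      s τ) (ϖPw r K t s τ) (hblindw r K t s τ) (hdepthw r K t s τ) (hϖPw r K t s τ) (hκwb r K s) (hκcb r K s) (hℓwb r K t s τ)
      (hcurlw r K t s τ) (hlenw r K t s τ) (𝓡𝒴w r K t s τ) (h𝓡𝒴w r K t s τ) (𝓡𝒵w r K t s τ) (𝓡ℬw r K t s τ) (h𝒢rw r K t s τ)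
      (hWrw r K t s τ) (hιrw r K t s τ) (hHrw r K t s τ) (hH₁rw r K t s τ) (hΦrw r K t s τ) (hskew r K t s τ) (Bp r K t s τ)
      (hBu r K t s τ) (hBd r K t s τ) (hd r K t s τ) (hdbar r K s) (hKw r K t s τ) hδ' (hϖ r K t s τ) (𝒢e r K t s τ) (W𝒱e r K t
      s τ) (h𝒢e r K t s τ) (hWe r K t s τ) hB₀e hC₄e hbe hε₄e hdome hselfe hcontre (H₁e r K t s τ) (hH₁e r K t s τ) (Φe r K t s
      τ) (hΦde r K t s τ) (hΦ0e r K t s τ) (hΦbe r K t s τ) hSre (ιe r K t s τ) (hιe r K t s τ) (He r K t s τ) (hHe r K t s τ)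
      (hqe r K s) (hRCe r K s) (I r K t s τ) hrE (hEd r K t s τ) (hEb r K t s τ) (he0 r K t s τ) (supp r K t s τ) (hblind r K t
      s τ) (ϖP r K t s τ) (hdepth r K t s τ) hLK (hK r K t s τ) (hcoupE r K s) (hElb₁ r K t s τ) (μ r K t s τ) (hg r K t s τ)
      (Aex r K t s τ) hBd0 (hint r K t s τ) (hpos r K t s τ) (hA r K t s τ) (hElb₂ r K t s τ) (L r K t s) (𝓡𝒵 r K t s) (𝓡ℬ r K t
      s) (h𝒢r r K t s) (hWr r K t s) (hιr r K t s) (hHr r K t s) (hH₁r r K t s) (hΦr r K t s) (hRdict r K t s τ) (hudict r K t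
      s) (hJW r K t s τ) (hJ r K t s τ) (hJ1 r K t s τ) (hWS r K t s τ) hδ0 hδ1 (hρ0 r (lvl r K s)) (hρ r (lvl r K s)) (hβ r (jl
      r K s)) (hη r (jl r K s)) (hε r (K - lvl r K s)) (hs₁ r K s) (ha r K s) (hma r K s) (hsm r K s) ha0 (hrad r K s) (hcover r
      K t s τ) (hcore r K t s) (hcollar r K t s τ))

end Summit.QuantumFields.BalabanUV.T4Continuum.ShellMeasureLiveEndOneCallSlotHistories

end
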